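/-
Copyright (c) 2026 the pub-hodgecm-mathlib formalisation cell (harness21).  Literature-prover seat hodgecm-mathlib-B-typ04 (g34) («B-ROTA-1» (iii),
off-rota Literature discharger): Jacobowitz's classification of hermitian forms of ranks 2 and 3 over an ABSTRACT `p`-adic field, 2026-09-04.
-/
import Literature.NumberTheory.LocalFields.LocalFieldInvolutionBinaryNormForm   -- ★ this seat: binary norm forms over a local field are universal (`…_localField`)
import Literature.NumberTheory.Automorphic.LocalHermitianRank3Classification   -- ★ `nonempty_formCongr_eq_iff_exists_det_eq_of_similar` (generic field core); brings ★ `LocalHermitianFormsRankThree`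
import Literature.NumberTheory.Automorphic.LocalHermitianPlaneCongruence       -- ★ `exists_formCongr_eq_of_hermForm_eq_one_of_det`, `det_formCongr_eq_mul_norm` (generic field cores)
import HarnessLib

/-!
# Hermitian forms of rank 2 and 3 over a `p`-adic field with an involution are classified by the norm class of the discriminant
# (Jacobowitz 1962, Thm. 3.1; Jacobson 1940, §3 (1)(a)) — the ABSTRACT-field edition (`IsNonarchimedeanLocalField E`)

Topic `NumberTheory/Automorphic`; namespace `Literature.NumberTheory.Automorphic.UnitaryGroup` (the tree's hermitian-form toolbox: `hermForm σ H`,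
`hermRow`, `formCongr σ T H = ᵗσ(T)·H·T`).  THEOREMS ONLY (kernel-checked; no definition, no named fact, no `sorry`, no instance, no notation);
count-neutral.  Cell `pub/hodgecm-mathlib`, seat B-typ04 (g34).

The tree proves the local classification of hermitian forms in the currency of number-field completions (`UnitaryGroup.LocalRing E v`,
`w.adicCompletion E`: ★ `LocalHermitianFormsRankThree`, ★ `LocalHermitianRank3Classification` §3, ★ `LocalHermitianPlaneCongruence` §2–§3), where the local
input «rank `≥ 3` isotropic ∕ rank `2` universal» is Jacobson's trace form + O'Meara 63:19 (★ `HermitianLocalIsotropy`).  This file is the same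
classification for an ABSTRACT non-archimedean local field `E` of characteristic `0` with an involution `σ ≠ id` (Mathlib `IsNonarchimedeanLocalField`),
the local input being ★ `LocalFieldInvolutionNorm.exists_isotropic_ternary_diagonal_localField` ∕ `exists_mul_norm_add_mul_norm_eq_localField` (binary norm
forms are universal; Serre V §3 on the tree's ramified-datum theory) and the generic field cores of the files above.

* §1 (any field `K` with `2 ≠ 0`, an involution `σ` moving some element, `H` `σ`-hermitian with `det H ≠ 0`): **`exists_orthogonal_basis_hermForm_self_ne_zero`**
  — an `h`-ORTHOGONAL basis with NON-ZERO (σ-fixed) diagonal values (★ `Semilinear.exists_orthogonal_basis_of_isSymm` + non-degeneracy).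
* §2 (`E` `p`-adic, rank 3): **`exists_hermForm_self_eq_zero_localField`** (every non-degenerate ternary hermitian form over `E` is ISOTROPIC),
  **`exists_formCongr_eq_smul_antidiag_three_localField`** (`ᵗσ(T)·H·T = a • Φ₃`, `a = σ a ≠ 0`: every such form is SIMILAR to the split form, by ★
  `exists_hyperbolic_partner_hermForm` + ★ `exists_formCongr_eq_smul_antidiag_of_hyperbolicPair`), and **`nonempty_formCongr_eq_iff_det_three_localField`**:
  `H ≅ H′ ↔ det H′ ∈ det H · N(E^×)` (Jacobowitz's theorem in rank 3, by ★ `nonempty_formCongr_eq_iff_exists_det_eq_of_similar`).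
* §3 (`E` `p`-adic, rank 2): **`exists_hermForm_self_eq_localField`** (every non-degenerate binary hermitian form over `E` REPRESENTS every `w ∈ F^×`),
  **`nonempty_formCongr_eq_iff_det_two_localField`**: `G ≅ G′ ↔ det G′ ∈ det G · N(E^×)` (Jacobowitz's theorem in rank 2, by ★
  `exists_formCongr_eq_of_hermForm_eq_one_of_det`).

HONEST LABEL: HC_CM is proved only modulo the 7 printed citations (2 remaining named inputs: hLiu418 = stmt-HodgeConjecture-24832, h413 =
stmt-HodgeConjecture-24833) until rung 0 closes; this file is off that cone, count-neutral (0 definitions, 0 named facts, 0 sorry).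

## References
* [Jacobowitz1962] R. Jacobowitz, *Hermitian forms over local fields*, Amer. J. Math. 84 (1962), §3 Thm. 3.1 (`E` a field: rank and discriminant).
* [Jacobson1940HermitianForms] N. Jacobson, *A note on hermitian forms*, Bull. AMS 46 (1940), §3 (1)(a) p. 267 («two forms are cogredient, if, and only if,
  they have the same discriminant»).
* [Rogawski1990] J. D. Rogawski, *Automorphic Representations of Unitary Groups in Three Variables* (1990), §3.5 p. 29, §14.2 p. 232 (i).
-/

set_option autoImplicit false

noncomputable section

open Matrix

namespace Literature.NumberTheory.Automorphic.UnitaryGroup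

/-! ## §1 Orthogonal bases with non-zero diagonal (any field) -/

section Field

variable {K : Type*} [Field K] (σ : K →+* K) {m : ℕ} (H : Matrix (Fin m) (Fin m) K)

/-- **An orthogonal basis with non-zero diagonal values.**  `2 ≠ 0`, `σ` an involution with `σ δ = −δ` for some `δ ≠ 0`, `H` `σ`-hermitian with
`det H ≠ 0`: `K^m` has a basis `b` with `h(b i, b j) = 0` (`i ≠ j`) and `h(b i, b i) ≠ 0`, `σ (h(b i, b i)) = h(b i, b i)` (an orthogonal basis by ★
`Semilinear.exists_orthogonal_basis_of_isSymm`; a basis vector with `h(b i, b i) = 0` would be orthogonal to everything, so its row `ᵗσ(b i)·H` would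
vanish, contradicting `det H ≠ 0`). [cite: Jacobowitz1962, §3 (orthogonal bases)] [cite: Jacobson1940HermitianForms, §2] -/
theorem exists_orthogonal_basis_hermForm_self_ne_zero (h2 : (2 : K) ≠ 0) {δ : K} (hδ : δ ≠ 0) (hσδ : σ δ = -δ)
    (hσ : ∀ s, σ (σ s) = s) (hH : (H.map σ)ᵀ = H) (hHd : H.det ≠ 0) :
    ∃ b : Module.Basis (Fin m) K (Fin m → K),
      (∀ i j, i ≠ j → hermForm σ H (b i) (b j) = 0) ∧ (∀ i, hermForm σ H (b i) (b i) ≠ 0) ∧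
        ∀ i, σ (hermForm σ H (b i) (b i)) = hermForm σ H (b i) (b i) := by
  classical
  set B := Matrix.toLinearMapₛₗ₂' K σ (RingHom.id K) H with hB
  have hBs : B.IsSymm := isSymm_toLinearMapₛₗ₂' σ H hσ hH
  obtain ⟨b₀, hb₀⟩ := Literature.LinearAlgebra.Semilinear.exists_orthogonal_basis_of_isSymm h2 hδ hσδ hBs
  let b : Module.Basis (Fin m) K (Fin m → K) := b₀.reindex (finCongr (Module.finrank_fin_fun K))
  have horth : ∀ i j, i ≠ j → hermForm σ H (b i) (b j) = 0 := by
    intro i j hij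
    have h : B (b i) (b j) = 0 := by
      simp only [b, Module.Basis.reindex_apply]
      exact hb₀ (fun h => hij (by simpa using congrArg (finCongr (Module.finrank_fin_fun K)) h))
    rwa [hB, toLinearMapₛₗ₂'_eq_hermForm] at h
  refine ⟨b, horth, fun i hi => ?_, fun i => conj_hermForm σ H hσ hH (b i) (b i)⟩
  -- `h(b i, ·) = 0` on the basis, hence everywhere
  have hzero : B (b i) = 0 := b.ext fun j => by
    rw [LinearMap.zero_apply, hB, toLinearMapₛₗ₂'_eq_hermForm]
    rcases eq_or_ne i j with rfl | hij
    · exact hi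
    · exact horth i j hij
  have hrow : hermRow σ H (b i) = 0 := by
    funext j
    rw [Pi.zero_apply, ← dotProduct_single_one (hermRow σ H (b i)) j, hermRow_dotProduct, ← toLinearMapₛₗ₂'_eq_hermForm, ← hB, hzero,
      LinearMap.zero_apply]
  have hinj := Matrix.vecMul_injective_iff_isUnit.2 ((Matrix.isUnit_iff_isUnit_det H).2 (Ne.isUnit hHd))
  have hσb : (⇑σ ∘ b i) = 0 :=
    hinj (show (⇑σ ∘ b i) ᵥ* H = (0 : Fin m → K) ᵥ* H by rw [Matrix.zero_vecMul]; exact hrow)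
  apply b.ne_zero i
  funext k
  have hk := congrFun hσb k
  simp only [Function.comp_apply, Pi.zero_apply] at hk
  have := congrArg σ hk
  rwa [hσ, map_zero] at this

/-- The value of `h` on a combination of three pairwise orthogonal vectors: `h(Σ gᵢ bᵢ, Σ gᵢ bᵢ) = Σ h(bᵢ,bᵢ)·(gᵢ·σgᵢ)`. [folklore] -/
private theorem hermForm_comb_three {b₀ b₁ b₂ : Fin m → K} (h01 : hermForm σ H b₀ b₁ = 0) (h02 : hermForm σ H b₀ b₂ = 0)
    (h12 : hermForm σ H b₁ b₂ = 0) (h10 : hermForm σ H b₁ b₀ = 0) (h20 : hermForm σ H b₂ b₀ = 0) (h21 : hermForm σ H b₂ b₁ = 0)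
    (g₀ g₁ g₂ : K) :
    hermForm σ H (g₀ • b₀ + g₁ • b₁ + g₂ • b₂) (g₀ • b₀ + g₁ • b₁ + g₂ • b₂) =
      hermForm σ H b₀ b₀ * (g₀ * σ g₀) + hermForm σ H b₁ b₁ * (g₁ * σ g₁) + hermForm σ H b₂ b₂ * (g₂ * σ g₂) := by
  simp only [hermForm_add_left, hermForm_add_right, hermForm_smul_left_eq, hermForm_smul_right, h01, h02, h12, h10, h20, h21]
  ring

/-- The value of `h` on a combination of two orthogonal vectors. [folklore] -/
private theorem hermForm_comb_two {b₀ b₁ : Fin m → K} (h01 : hermForm σ H b₀ b₁ = 0) (h10 : hermForm σ H b₁ b₀ = 0) (g₀ g₁ : K) :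
    hermForm σ H (g₀ • b₀ + g₁ • b₁) (g₀ • b₀ + g₁ • b₁) = hermForm σ H b₀ b₀ * (g₀ * σ g₀) + hermForm σ H b₁ b₁ * (g₁ * σ g₁) := by
  simp only [hermForm_add_left, hermForm_add_right, hermForm_smul_left_eq, hermForm_smul_right, h01, h10]
  ring

end Field

/-! ## §2 Rank 3 over a `p`-adic field: isotropy, similarity to `Φ₃`, classification by the discriminant -/

section LocalField

open Literature.NumberTheory.LocalFields

variable {E : Type} [Field E] [ValuativeRel E] [TopologicalSpace E] [IsNonarchimedeanLocalField E]

omit [ValuativeRel E] [TopologicalSpace E] [IsNonarchimedeanLocalField E] in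
/-- An involution `σ ≠ id` moves some `δ ≠ 0` to `−δ` (`δ = x − σ x`). [folklore] -/
private theorem exists_skew_of_ne {σ : E →+* E} (hσ : ∀ x, σ (σ x) = x) (hσ1 : σ ≠ RingHom.id E) :
    ∃ δ : E, δ ≠ 0 ∧ σ δ = -δ := by
  have h : ∃ x, σ x ≠ x := by
    by_contra h
    push Not at h
    exact hσ1 (RingHom.ext h)
  obtain ⟨x, hx⟩ := h
  exact ⟨x - σ x, sub_ne_zero.2 (Ne.symm hx), by rw [map_sub, hσ, neg_sub]⟩

/-- **EVERY NON-DEGENERATE TERNARY HERMITIAN FORM OVER A `p`-ADIC FIELD IS ISOTROPIC**: `E` a non-archimedean local field of characteristic `0`,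
`σ ≠ id` an involution, `H ∈ M₃(E)` `σ`-hermitian with `det H ≠ 0` ⇒ `h(x,x) = 0` for some `x ≠ 0`.  (Orthogonal basis §1; the diagonal ternary form
`⟨h(b₀,b₀), h(b₁,b₁), h(b₂,b₂)⟩` is isotropic by ★ `LocalFieldInvolutionNorm.exists_isotropic_ternary_diagonal_localField`.)
[cite: Jacobson1940HermitianForms, §3 (1)(a) p. 267] [cite: Jacobowitz1962, §3 Thm. 3.1] -/
theorem exists_hermForm_self_eq_zero_localField [CharZero E] {σ : E →+* E} (hσ : ∀ x, σ (σ x) = x) (hσ1 : σ ≠ RingHom.id E)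
    {H : Matrix (Fin 3) (Fin 3) E} (hH : (H.map σ)ᵀ = H) (hHd : H.det ≠ 0) :
    ∃ x : Fin 3 → E, x ≠ 0 ∧ hermForm σ H x x = 0 := by
  classical
  obtain ⟨δ, hδ, hσδ⟩ := exists_skew_of_ne hσ hσ1
  obtain ⟨b, horth, hdiag, hfix⟩ := exists_orthogonal_basis_hermForm_self_ne_zero σ H two_ne_zero hδ hσδ hσ hH hHd
  obtain ⟨g₀, g₁, g₂, hg₂, hsum⟩ := LocalFieldInvolutionNorm.exists_isotropic_ternary_diagonal_localField σ hσ hσ1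
    (hfix 0) (hdiag 0) (hfix 1) (hdiag 1) (hfix 2) (hdiag 2)
  refine ⟨g₀ • b 0 + g₁ • b 1 + g₂ • b 2, fun h0 => hg₂ ?_, ?_⟩
  · have h := congrArg (fun v => b.repr v 2) h0
    simpa [map_add, map_smul, Module.Basis.repr_self, Finsupp.single_apply] using h
  · rw [hermForm_comb_three σ H (horth 0 1 (by decide)) (horth 0 2 (by decide)) (horth 1 2 (by decide)) (horth 1 0 (by decide))
      (horth 2 0 (by decide)) (horth 2 1 (by decide)), hsum]

/-- **EVERY NON-DEGENERATE TERNARY HERMITIAN FORM OVER A `p`-ADIC FIELD IS SIMILAR TO THE SPLIT FORM**: `ᵗσ(T)·H·T = a • Φ₃` for some `T ∈ GL₃(E)` and a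
`σ`-fixed `a ≠ 0`, `Φ₃ = antidiag(1,1,1)` (an isotropic vector, a hyperbolic partner ★ `exists_hyperbolic_partner_hermForm`, Witt completion ★
`exists_formCongr_eq_smul_antidiag_of_hyperbolicPair`). [cite: Jacobowitz1962, §3 Thm. 3.1] [cite: Rogawski1990, §14.2 p. 232 (i)] -/
theorem exists_formCongr_eq_smul_antidiag_three_localField [CharZero E] {σ : E →+* E} (hσ : ∀ x, σ (σ x) = x) (hσ1 : σ ≠ RingHom.id E)
    {H : Matrix (Fin 3) (Fin 3) E} (hH : (H.map σ)ᵀ = H) (hHd : H.det ≠ 0) :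
    ∃ (T : GL (Fin 3) E) (a : E), a ≠ 0 ∧ σ a = a ∧
      formCongr σ T H = a • Matrix.of fun i j : Fin 3 => if i.val + j.val + 1 = 3 then (1 : E) else 0 := by
  obtain ⟨x, hx0, hx⟩ := exists_hermForm_self_eq_zero_localField hσ hσ1 hH hHd
  obtain ⟨y, hy, hxy⟩ := exists_hyperbolic_partner_hermForm σ H two_ne_zero hσ hH hHd hx hx0
  exact exists_formCongr_eq_smul_antidiag_of_hyperbolicPair σ H hσ hH hHd hx hy hxy

/-- **JACOBOWITZ'S THEOREM IN RANK 3 OVER A `p`-ADIC FIELD**: two non-degenerate `σ`-hermitian `H, H′ ∈ M₃(E)` are congruent (`ᵗσ(U)·H·U = H′`) iff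
their discriminants differ by a norm: `det H′ = σ z · z · det H` for some `z ≠ 0`. [cite: Jacobowitz1962, §3 Thm. 3.1]
[cite: Jacobson1940HermitianForms, §3 (1)(a) p. 267] [cite: Rogawski1990, §3.5 p. 29] -/
theorem nonempty_formCongr_eq_iff_det_three_localField [CharZero E] {σ : E →+* E} (hσ : ∀ x, σ (σ x) = x) (hσ1 : σ ≠ RingHom.id E)
    {H H' : Matrix (Fin 3) (Fin 3) E} (hH : (H.map σ)ᵀ = H) (hHd : H.det ≠ 0) (hH' : (H'.map σ)ᵀ = H') (hHd' : H'.det ≠ 0) :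
    (∃ U : GL (Fin 3) E, formCongr σ U H = H') ↔ ∃ z : E, z ≠ 0 ∧ H'.det = σ z * z * H.det := by
  obtain ⟨T, a, ha0, ha, hT⟩ := exists_formCongr_eq_smul_antidiag_three_localField hσ hσ1 hH hHd
  obtain ⟨T', a', ha0', ha', hT'⟩ := exists_formCongr_eq_smul_antidiag_three_localField hσ hσ1 hH' hHd'
  have hΦ : (Matrix.of fun i j : Fin 3 => if i.val + j.val + 1 = 3 then (1 : E) else 0).det ≠ 0 := by
    rw [Matrix.det_fin_three]
    simp [Matrix.of_apply]
  exact nonempty_formCongr_eq_iff_exists_det_eq_of_similar σ hΦ ha0 ha ha0' ha' hT hT'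

/-! ## §3 Rank 2 over a `p`-adic field: universality and classification by the discriminant -/

/-- **EVERY NON-DEGENERATE BINARY HERMITIAN FORM OVER A `p`-ADIC FIELD REPRESENTS EVERY `w ∈ F^×`**: `G ∈ M₂(E)` `σ`-hermitian, `det G ≠ 0`,
`w = σ w ≠ 0` ⇒ `h_G(x,x) = w` for some `x` (orthogonal basis §1 and ★ `LocalFieldInvolutionNorm.exists_mul_norm_add_mul_norm_eq_localField`).
[cite: Jacobson1940HermitianForms, §3 (1)(a) p. 267] [cite: Jacobowitz1962, §3 Thm. 3.1] -/
theorem exists_hermForm_self_eq_localField [CharZero E] {σ : E →+* E} (hσ : ∀ x, σ (σ x) = x) (hσ1 : σ ≠ RingHom.id E)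
    {G : Matrix (Fin 2) (Fin 2) E} (hG : (G.map σ)ᵀ = G) (hGd : G.det ≠ 0) {w : E} (hσw : σ w = w) (hw0 : w ≠ 0) :
    ∃ x : Fin 2 → E, hermForm σ G x x = w := by
  classical
  obtain ⟨δ, hδ, hσδ⟩ := exists_skew_of_ne hσ hσ1
  obtain ⟨b, horth, hdiag, hfix⟩ := exists_orthogonal_basis_hermForm_self_ne_zero σ G two_ne_zero hδ hσδ hσ hG hGd
  obtain ⟨g₀, g₁, hsum⟩ := LocalFieldInvolutionNorm.exists_mul_norm_add_mul_norm_eq_localField σ hσ hσ1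
    (hfix 0) (hdiag 0) (hfix 1) (hdiag 1) hσw hw0
  refine ⟨g₀ • b 0 + g₁ • b 1, ?_⟩
  rw [hermForm_comb_two σ G (horth 0 1 (by decide)) (horth 1 0 (by decide)), hsum]

/-- **JACOBOWITZ'S THEOREM IN RANK 2 OVER A `p`-ADIC FIELD**: two non-degenerate `σ`-hermitian `G, G′ ∈ M₂(E)` are congruent iff their discriminants
differ by a norm. [cite: Jacobowitz1962, §3 Thm. 3.1] [cite: Jacobson1940HermitianForms, §3 (1)(a) p. 267] -/
theorem nonempty_formCongr_eq_iff_det_two_localField [CharZero E] {σ : E →+* E} (hσ : ∀ x, σ (σ x) = x) (hσ1 : σ ≠ RingHom.id E)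
    {G G' : Matrix (Fin 2) (Fin 2) E} (hG : (G.map σ)ᵀ = G) (hGd : G.det ≠ 0) (hG' : (G'.map σ)ᵀ = G') (hGd' : G'.det ≠ 0) :
    (∃ U : GL (Fin 2) E, formCongr σ U G = G') ↔ ∃ z : E, z ≠ 0 ∧ G'.det = σ z * z * G.det := by
  constructor
  · rintro ⟨U, hU⟩
    obtain ⟨z, hz, h⟩ := exists_isUnit_det_eq_of_formCongr_eq σ hU
    exact ⟨z, hz.ne_zero, h⟩
  · rintro ⟨z, hz0, hz⟩
    obtain ⟨x, hx⟩ := exists_hermForm_self_eq_localField hσ hσ1 hG hGd (by rw [map_one]) one_ne_zero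
    obtain ⟨x', hx'⟩ := exists_hermForm_self_eq_localField hσ hσ1 hG' hGd' (by rw [map_one]) one_ne_zero
    exact exists_formCongr_eq_of_hermForm_eq_one_of_det σ hσ hG hG' hGd hx hx' ⟨z, hz0, by rw [hz]; ring⟩

end LocalField

end Literature.NumberTheory.Automorphic.UnitaryGroup

end
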